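import Summits.BirchSwinnertonDyer.BirchSwinnertonDyer.Theorems.AlignedTransportAtTwoMainConjectureOfRankZeroBSDAtTwoCubicElementaryLayerDoor
import Summits.BirchSwinnertonDyer.BirchSwinnertonDyer.Theorems.AlignedTransportAtTwoMainConjectureOfRankZeroBSDAtTwoCubicGenusCertE1RowN3027
import Summits.BirchSwinnertonDyer.BirchSwinnertonDyer.Theorems.AlignedTransportAtTwoMainConjectureOfRankZeroBSDAtTwoCubicGenusCertE1RowN3523
import Summits.BirchSwinnertonDyer.BirchSwinnertonDyer.Theorems.AlignedTransportAtTwoMainConjectureOfRankZeroBSDAtTwoCubicGenusCertE1RowN14891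
import HarnessLib

/-!
# Route `AlignedTransportAtTwo`, crux C2 `MainConjectureOfRankZeroBSDAtTwo` (stmt-BirchSwinnertonDyer-22298):
# THE ELEMENTARY-LAYER DOOR ON THE HARD CORE — rows `N = 3027, 3523, 14891` (`t = 3`, `e₁ = 1`, dead at layer `2` for every unit / rank door):
# `μ₂ = 0`, `λ₂ ≤ 2^k − 2` for the cubic `2`-torsion field as soon as ONE layer has `ord₂ h(K_k) ≠ 2^k − 1` (e.g. `ord₂ h(K_2) ≠ 3`), and `MC₂(W)` modulo PRINT⁵ + MuIneqʳ

HONEST FRAMING (cell `bsd-f1-sign2`, WIDTH-5 attached prover seat `bsd-line-att-p3` gen 47 on line `birth`; `--supports` stmt-BirchSwinnertonDyer-22298, closes nothing;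
BSD is NOT proved by any of this; C2, its verdict and every registered stub are untouched).  THEOREMS ONLY — no definition, no named fact, no `sorry`.
For each of the three HARD-CORE seeds of the cell's census (att-p3 g44/g45: `t = 3`, `e₁ = 1`, regime (β), layer-`2` unit door DEAD, capitulation door silent, no
rank datum of `K₂` known) every displayed input of this seat's door `…CubicElementaryLayerDoor.classicalMuVanishes_adjoin_of_classNumberPExp_ne` EXCEPT the layer class
number is ALREADY a tree theorem: `h(ℚ(β)) = 1` (att-p4 g38 `…CubicDoorsDeadSubcellClassNumber{D,B,H}`), `2 ∤ d_{ℚ(β)}` (`CubicDisc{3027,3523,14891}.discr_eq`), and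
`e₁ = ord₂ h(ℚ(β,√2)) = 1` (att-p4's genus rows `…CubicGenusCertE1RowN{3027,3523,14891}`).  So for these seeds the `μ₂ = 0` question is now EXACTLY:
**is `ord₂ h(K_k) ≠ 2^k − 1` for some layer `k ≥ 2`** (`K_2 = ℚ(β, ζ₁₆ + ζ₁₆⁻¹)`, degree `12`: «`ord₂ h(K_2) ≠ 3`»; a class number, or ONE ideal class of order `4`) —
the only case the door leaves open is the `μ > 0`-shaped tower `Cl(K_k)[2^∞] ≅ (ℤ/2)^{2^k−1}` at every layer.

* ★★ `classicalMuVanishes_cubicField_n{3027,3523,14891}_of_classNumberPExp_ne` — `β` any root of the `2`-division cubic, `κ` any cyclotomic `ℤ₂`-extension of `ℚ(β)`,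
  **`ord₂ h(K_k) ≠ 2^k − 1` ⟹ `rank₂ Cl(K_m) ≤ 2^k − 2 ∀ m`, `μ₂(κ) = 0`, `λ₂(κ) ≤ 2^k − 2`** — UNCONDITIONAL implications (no PRINT, no stub);
  `…_of_orderOf_eq_four` — the same from ONE class of order `4` in `Cl(K_k)`.
* ★ `mazurMainConjecture_two_n{3027,3523,14891}_of_classNumberPExp_ne` — `C2` at the seed modulo PRINT⁵ + MuIneqʳ (registered stub VERBATIM) + the crux's own hypotheses
  (`r_an = 0`, analytic `μ₂ = 0`, `BSD₂(W)`) + the displayed layer datum (att-p5 g24's carrier road).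

References: [Washington1997] §13.3 Prop. 13.22–13.23; [Fukuda1994] Thm. 1, p. 264; [Kato2004Asterisque] Thm. 17.4 (1)(2); [GreenbergLNM1716] Thm. 4.1; [LMFDB] ec 3027, 3523,
14891; nf 3.1.3027.1, 3.1.3523.1, 3.1.14891.1; tree: this seat's `…CubicElementaryLayerDoor`, att-p4 g38/g39 rows.
-/

set_option linter.dupNamespace false
set_option autoImplicit false

noncomputable section

open scoped Classical NumberField nonZeroDivisors IntermediateField

namespace Summit.BirchSwinnertonDyer.BirchSwinnertonDyer.Theorems.AlignedTransportAtTwoCubicElementaryLayerRows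

open NumberField IsDedekindDomain Polynomial WeierstrassCurve IntermediateField CongruenceSubgroup Module
  Literature.NumberTheory.IwasawaTheory Literature.NumberTheory.GaloisRepresentations
  Literature.NumberTheory.EllipticCurves Literature.NumberTheory.EllipticCurves.Greenberg1999
  Literature.NumberTheory.EllipticCurves.ModularForms Literature.NumberTheory.EllipticCurves.Rank1Residual
  Literature.NumberTheory.EllipticCurves.Module
  Literature.NumberTheory.NumberFields Literature.NumberTheory.CubicFields
  Summit.BirchSwinnertonDyer.Rank1Residual Summit.BirchSwinnertonDyer.Rank1Residual.X1.MuLambda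
  Summit.BirchSwinnertonDyer.Rank1Residual.X5 Summit.BirchSwinnertonDyer.Rank1Residual.X5.O1
  Summit.BirchSwinnertonDyer.Rank1Residual.X5.Instances Summit.BirchSwinnertonDyer.Rank1Residual.F1Sign2
  Summit.BirchSwinnertonDyer.BirchSwinnertonDyer.Theorems.Rank1ResidualX1Defs
  Summit.BirchSwinnertonDyer.BirchSwinnertonDyer.Theses.AlignedTransportAtTwo
  Summit.BirchSwinnertonDyer.BirchSwinnertonDyer.Theorems.AlignedTransportAtTwoKilfordStratumShared
  Summit.BirchSwinnertonDyer.BirchSwinnertonDyer.Theorems.AlignedTransportAtTwoCubicCarrierRoad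
  Summit.BirchSwinnertonDyer.BirchSwinnertonDyer.Theorems.AlignedTransportAtTwoCubicElementaryLayerDoor
  Summit.BirchSwinnertonDyer.BirchSwinnertonDyer.Theorems.AlignedTransportAtTwoCubicDoorsDeadSubcellClassNumberD
  Summit.BirchSwinnertonDyer.BirchSwinnertonDyer.Theorems.AlignedTransportAtTwoCubicGenusCertE1RowN3027
  Summit.BirchSwinnertonDyer.BirchSwinnertonDyer.Theorems.AlignedTransportAtTwoCubicDoorsDeadSubcellClassNumberB
  Summit.BirchSwinnertonDyer.BirchSwinnertonDyer.Theorems.AlignedTransportAtTwoCubicGenusCertE1RowN3523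
  Summit.BirchSwinnertonDyer.BirchSwinnertonDyer.Theorems.AlignedTransportAtTwoCubicDoorsDeadSubcellClassNumberH
  Summit.BirchSwinnertonDyer.BirchSwinnertonDyer.Theorems.AlignedTransportAtTwoCubicGenusCertE1RowN14891

/-! ## §1 `N = 3027`: the curve `⟨1, 0, 1, -19, 29⟩`, cubic field of discriminant `−3027` -/

/-- The `2`-division cubic of `⟨1, 0, 1, -19, 29⟩` has a root in `ℚ̄`. [cite: SilvermanAEC2009, III.1] -/
theorem exists_root_twoTorsionPolynomial_n3027 :
    ∃ β : AlgebraicClosure ℚ, aeval β ((⟨1, 0, 1, -19, 29⟩ : WeierstrassCurve ℤ).baseChange ℚ).twoTorsionPolynomial.toPoly = 0 := by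
  apply IsAlgClosed.exists_aeval_eq_zero
  rw [Cubic.degree_of_a_ne_zero (by simp [WeierstrassCurve.twoTorsionPolynomial])]
  decide

/-- ★★ **`N = 3027` (hard core): `ord₂ h(K_k) ≠ 2^k − 1` for ONE layer ⟹ `rank₂ Cl(K_m) ≤ 2^k − 2 ∀ m`, `μ₂ = 0`, `λ₂ ≤ 2^k − 2`** — for `β` ANY root of the
`2`-division cubic of `⟨1, 0, 1, -19, 29⟩` and EVERY cyclotomic `ℤ₂`-extension `κ` of `ℚ(β)` (cubic field of discriminant `−3027`); the other inputs of the door (`h = 1`,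
`2 ∤ d`, `e₁ = 1`) are tree theorems.  UNCONDITIONAL implication. [cite: Washington1997, §13.3 Prop. 13.22–13.23] [cite: Fukuda1994, Thm. 1, p. 264]
[cite: LMFDB, number field 3.1.3027.1 (class number 1)] -/
theorem classicalMuVanishes_cubicField_n3027_of_classNumberPExp_ne {β : AlgebraicClosure ℚ}
    (hβ : aeval β ((⟨1, 0, 1, -19, 29⟩ : WeierstrassCurve ℤ).baseChange ℚ).twoTorsionPolynomial.toPoly = 0)
    (κP : ZpExtension ↥(IntermediateField.adjoin ℚ ({β} : Set (AlgebraicClosure ℚ))) 2) (hκP : κP.IsCyclotomic)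
    {k : ℕ} (hk : classNumberPExp κP k ≠ 2 ^ k - 1) :
    (∀ m, classGroupPRank κP m ≤ 2 ^ k - 2) ∧ ClassicalMuVanishes κP ∧ classicalLambda κP ≤ 2 ^ k - 2 := by
  haveI := isElliptic_n3027
  haveI := isGloballyMinimal_n3027
  haveI : FiniteDimensional ℚ ↥(IntermediateField.adjoin ℚ ({β} : Set (AlgebraicClosure ℚ))) :=
    IntermediateField.adjoin.finiteDimensional ((AlgebraicClosure.isAlgebraic ℚ).isAlgebraic β).isIntegral
  haveI : NumberField ↥(IntermediateField.adjoin ℚ ({β} : Set (AlgebraicClosure ℚ))) := NumberField.mk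
  have hθ := aeval_theta_n3027 hβ
  have h3 := finrank_cubicField_n3027 hβ
  have hd : ¬ (2 : ℤ) ∣ NumberField.discr ↥(IntermediateField.adjoin ℚ ({β} : Set (AlgebraicClosure ℚ))) := by
    rw [CubicDisc3027.discr_eq h3 hθ]; norm_num
  exact AlignedTransportAtTwoCubicElementaryLayerDoor.classicalMuVanishes_adjoin_of_classNumberPExp_ne ((⟨1, 0, 1, -19, 29⟩ : WeierstrassCurve ℤ).baseChange ℚ) not_hasRationalTwoTorsionX_n3027 hβ
    (not_two_dvd_classNumber_cubicField_n3027 hβ) hd κP hκP (le_of_eq (classNumberPExp_one_cubicField_n3027 hβ κP hκP)) hk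

/-- **`N = 3027`: ONE ideal class of order `4` in some layer `Cl(K_k)` ⟹ `rank₂ Cl(K_m) ≤ 2^k − 2 ∀ m`, `μ₂ = 0`, `λ₂ ≤ 2^k − 2`** (unconditional implication).
[cite: Washington1997, §13.3 Prop. 13.22–13.23] [cite: Fukuda1994, Thm. 1, p. 264] [cite: LMFDB, number field 3.1.3027.1] -/
theorem classicalMuVanishes_cubicField_n3027_of_orderOf_eq_four {β : AlgebraicClosure ℚ}
    (hβ : aeval β ((⟨1, 0, 1, -19, 29⟩ : WeierstrassCurve ℤ).baseChange ℚ).twoTorsionPolynomial.toPoly = 0)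
    (κP : ZpExtension ↥(IntermediateField.adjoin ℚ ({β} : Set (AlgebraicClosure ℚ))) 2) (hκP : κP.IsCyclotomic)
    {k : ℕ} {c : ClassGroup (𝓞 (κP.layer k))} (hc : orderOf c = 4) :
    (∀ m, classGroupPRank κP m ≤ 2 ^ k - 2) ∧ ClassicalMuVanishes κP ∧ classicalLambda κP ≤ 2 ^ k - 2 := by
  haveI := isElliptic_n3027
  haveI := isGloballyMinimal_n3027
  haveI : FiniteDimensional ℚ ↥(IntermediateField.adjoin ℚ ({β} : Set (AlgebraicClosure ℚ))) :=
    IntermediateField.adjoin.finiteDimensional ((AlgebraicClosure.isAlgebraic ℚ).isAlgebraic β).isIntegral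
  haveI : NumberField ↥(IntermediateField.adjoin ℚ ({β} : Set (AlgebraicClosure ℚ))) := NumberField.mk
  have hθ := aeval_theta_n3027 hβ
  have h3 := finrank_cubicField_n3027 hβ
  have hd : ¬ (2 : ℤ) ∣ NumberField.discr ↥(IntermediateField.adjoin ℚ ({β} : Set (AlgebraicClosure ℚ))) := by
    rw [CubicDisc3027.discr_eq h3 hθ]; norm_num
  exact AlignedTransportAtTwoCubicElementaryLayerDoor.classicalMuVanishes_adjoin_of_orderOf_eq_four ((⟨1, 0, 1, -19, 29⟩ : WeierstrassCurve ℤ).baseChange ℚ) not_hasRationalTwoTorsionX_n3027 hβ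
    (not_two_dvd_classNumber_cubicField_n3027 hβ) hd κP hκP (le_of_eq (classNumberPExp_one_cubicField_n3027 hβ κP hκP)) hc

/-- ★ **`C2` AT THE SEED `⟨1, 0, 1, -19, 29⟩` (`N = 3027`) MODULO ONE LAYER CLASS NUMBER**: PRINT⁵ {`h17` Kato 17.4 (1)(2) at `2`, `hGr` Greenberg 4.1, `hper` period unit,
`hmod` modularity, `hGZK`} + `hI` = MuIneqʳ (the registered stub of line `birth`, VERBATIM) + the crux's own hypotheses at this `W` (`r_an = 0`, analytic `μ₂ = 0` on the
even branch, `BSD₂(W)`) + the displayed datum «for every root `β` and every cyclotomic `ℤ₂`-extension of `ℚ(β)` SOME layer has `ord₂ h(K_k) ≠ 2^k − 1`» ⟹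
`MazurMainConjecture W 2` (att-p5 g24's carrier road).  CONDITIONAL; BSD is NOT proved; nothing is closed. [cite: Kato2004Asterisque, Thm. 17.4 (1)(2) (p. 273)]
[cite: GreenbergLNM1716, Thm. 4.1 (p. 102) and Conj. 1.11 (p. 58)] [cite: Iwasawa1973MuInvariants, Thm. 2 and Thm. 3] [cite: Fukuda1994, Thm. 1, p. 264] -/
theorem mazurMainConjecture_two_n3027_of_classNumberPExp_ne
    [((⟨1, 0, 1, -19, 29⟩ : WeierstrassCurve ℤ).baseChange ℚ).IsElliptic] [((⟨1, 0, 1, -19, 29⟩ : WeierstrassCurve ℤ).baseChange ℚ).IsGloballyMinimal]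
    (h17 : ∀ [NeZero (((⟨1, 0, 1, -19, 29⟩ : WeierstrassCurve ℤ).baseChange ℚ).conductorNorm ℤ)] (f : CuspForm (Gamma0 (((⟨1, 0, 1, -19, 29⟩ : WeierstrassCurve ℤ).baseChange ℚ).conductorNorm ℤ)) 2),
      kato_divisibility_allPrimes ((⟨1, 0, 1, -19, 29⟩ : WeierstrassCurve ℤ).baseChange ℚ) 2 (f := f))
    (hGr : Greenberg1999.thm41_charValue_rankZero_anyPrime)
    (hper : realPeriodRat_eq_unit_mul_plusPeriod_two) (hmod : nonempty_modularParametrizationData)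
    (hGZK : rank_eq_analyticRank_of_analyticRank_le_one)
    (hI : ∀ (W : WeierstrassCurve ℚ) [W.IsElliptic] [W.IsGloballyMinimal], IsOrdinaryAt W 2 →
      (∀ x : ℚ, ¬ HasRationalTwoTorsionX W x) →
      ∀ (κ : ZpExtension ℚ 2) (γ : Field.absoluteGaloisGroup ℚ), κ.IsCyclotomic →
      κ.IsTopGenerator γ → IsCyclotomicVariable 2 γ →
      ∀ ⦃N : ℕ⦄ [NeZero N] (f : CuspForm (Gamma0 N) 2), IsNewformOf W f →
      ∀ Gp : IwasawaAlgebra 2, iwasawaToPowerSeries 2 Gp = padicLFunction f (unitRoot W 2 : ℚ_[2]) →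
      ∀ (D : W.SelmerDualData κ γ) (Yr : W.FineSelmerDualDataRelaxedInf κ γ),
        lengthAt (IwasawaAlgebra 2) D.X ⟨IwasawaAlgebra.augIdealP 2, IwasawaAlgebra.isPrime_augIdealP_holds 2⟩ ≤
          lengthAt (IwasawaAlgebra 2) (IwasawaAlgebra 2 ⧸ Ideal.span {Gp})
              ⟨IwasawaAlgebra.augIdealP 2, IwasawaAlgebra.isPrime_augIdealP_holds 2⟩ +
            lengthAt (IwasawaAlgebra 2) Yr.X ⟨IwasawaAlgebra.augIdealP 2, IwasawaAlgebra.isPrime_augIdealP_holds 2⟩)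
    (hr : ((⟨1, 0, 1, -19, 29⟩ : WeierstrassCurve ℤ).baseChange ℚ).analyticRank = 0)
    (hμan : ∀ ⦃N : ℕ⦄ [NeZero N] (f : CuspForm (Gamma0 N) 2), IsNewformOf ((⟨1, 0, 1, -19, 29⟩ : WeierstrassCurve ℤ).baseChange ℚ) f →
      ∀ G : IwasawaAlgebra 2, IsEvenBranchLiftAtTwo ((⟨1, 0, 1, -19, 29⟩ : WeierstrassCurve ℤ).baseChange ℚ) f G → red G ≠ 0)
    (hbsd : BSDp ((⟨1, 0, 1, -19, 29⟩ : WeierstrassCurve ℤ).baseChange ℚ) 2)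
    (hdata : ∀ (β : AlgebraicClosure ℚ), aeval β ((⟨1, 0, 1, -19, 29⟩ : WeierstrassCurve ℤ).baseChange ℚ).twoTorsionPolynomial.toPoly = 0 →
      ∀ κP : ZpExtension ↥(IntermediateField.adjoin ℚ ({β} : Set (AlgebraicClosure ℚ))) 2, κP.IsCyclotomic → ∃ k : ℕ, classNumberPExp κP k ≠ 2 ^ k - 1) :
    MazurMainConjecture ((⟨1, 0, 1, -19, 29⟩ : WeierstrassCurve ℤ).baseChange ℚ) 2 := by
  obtain ⟨β, hβ⟩ := exists_root_twoTorsionPolynomial_n3027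
  have hord : IsOrdinaryAt ((⟨1, 0, 1, -19, 29⟩ : WeierstrassCurve ℤ).baseChange ℚ) 2 := goodOrd_two_n3027
  exact mazurMainConjecture_two_of_muIneqRel_of_classicalMu_cubicField_of_Δ_neg ((⟨1, 0, 1, -19, 29⟩ : WeierstrassCurve ℤ).baseChange ℚ) h17 hGr hper hmod hGZK hI hord
    not_hasRationalTwoTorsionX_n3027 Δ_n3027_neg hr hμan hbsd hβ (fun κP hκP => by
      obtain ⟨k, hk⟩ := hdata β hβ κP hκP
      exact (classicalMuVanishes_cubicField_n3027_of_classNumberPExp_ne hβ κP hκP hk).2.1)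

/-! ## §2 `N = 3523`: the curve `⟨1, 1, 1, 2, -2⟩`, cubic field of discriminant `−3523` -/

/-- The `2`-division cubic of `⟨1, 1, 1, 2, -2⟩` has a root in `ℚ̄`. [cite: SilvermanAEC2009, III.1] -/
theorem exists_root_twoTorsionPolynomial_n3523 :
    ∃ β : AlgebraicClosure ℚ, aeval β ((⟨1, 1, 1, 2, -2⟩ : WeierstrassCurve ℤ).baseChange ℚ).twoTorsionPolynomial.toPoly = 0 := by
  apply IsAlgClosed.exists_aeval_eq_zero
  rw [Cubic.degree_of_a_ne_zero (by simp [WeierstrassCurve.twoTorsionPolynomial])]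
  decide

/-- ★★ **`N = 3523` (hard core): `ord₂ h(K_k) ≠ 2^k − 1` for ONE layer ⟹ `rank₂ Cl(K_m) ≤ 2^k − 2 ∀ m`, `μ₂ = 0`, `λ₂ ≤ 2^k − 2`** — for `β` ANY root of the
`2`-division cubic of `⟨1, 1, 1, 2, -2⟩` and EVERY cyclotomic `ℤ₂`-extension `κ` of `ℚ(β)` (cubic field of discriminant `−3523`); the other inputs of the door (`h = 1`,
`2 ∤ d`, `e₁ = 1`) are tree theorems.  UNCONDITIONAL implication. [cite: Washington1997, §13.3 Prop. 13.22–13.23] [cite: Fukuda1994, Thm. 1, p. 264]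
[cite: LMFDB, number field 3.1.3523.1 (class number 1)] -/
theorem classicalMuVanishes_cubicField_n3523_of_classNumberPExp_ne {β : AlgebraicClosure ℚ}
    (hβ : aeval β ((⟨1, 1, 1, 2, -2⟩ : WeierstrassCurve ℤ).baseChange ℚ).twoTorsionPolynomial.toPoly = 0)
    (κP : ZpExtension ↥(IntermediateField.adjoin ℚ ({β} : Set (AlgebraicClosure ℚ))) 2) (hκP : κP.IsCyclotomic)
    {k : ℕ} (hk : classNumberPExp κP k ≠ 2 ^ k - 1) :
    (∀ m, classGroupPRank κP m ≤ 2 ^ k - 2) ∧ ClassicalMuVanishes κP ∧ classicalLambda κP ≤ 2 ^ k - 2 := by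
  haveI := isElliptic_n3523
  haveI := isGloballyMinimal_n3523
  haveI : FiniteDimensional ℚ ↥(IntermediateField.adjoin ℚ ({β} : Set (AlgebraicClosure ℚ))) :=
    IntermediateField.adjoin.finiteDimensional ((AlgebraicClosure.isAlgebraic ℚ).isAlgebraic β).isIntegral
  haveI : NumberField ↥(IntermediateField.adjoin ℚ ({β} : Set (AlgebraicClosure ℚ))) := NumberField.mk
  have hθ := aeval_theta_n3523 hβ
  have h3 := finrank_cubicField_n3523 hβ
  have hd : ¬ (2 : ℤ) ∣ NumberField.discr ↥(IntermediateField.adjoin ℚ ({β} : Set (AlgebraicClosure ℚ))) := by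
    rw [CubicDisc3523.discr_eq h3 hθ]; norm_num
  exact AlignedTransportAtTwoCubicElementaryLayerDoor.classicalMuVanishes_adjoin_of_classNumberPExp_ne ((⟨1, 1, 1, 2, -2⟩ : WeierstrassCurve ℤ).baseChange ℚ) not_hasRationalTwoTorsionX_n3523 hβ
    (not_two_dvd_classNumber_cubicField_n3523 hβ) hd κP hκP (le_of_eq (classNumberPExp_one_cubicField_n3523 hβ κP hκP)) hk

/-- **`N = 3523`: ONE ideal class of order `4` in some layer `Cl(K_k)` ⟹ `rank₂ Cl(K_m) ≤ 2^k − 2 ∀ m`, `μ₂ = 0`, `λ₂ ≤ 2^k − 2`** (unconditional implication).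
[cite: Washington1997, §13.3 Prop. 13.22–13.23] [cite: Fukuda1994, Thm. 1, p. 264] [cite: LMFDB, number field 3.1.3523.1] -/
theorem classicalMuVanishes_cubicField_n3523_of_orderOf_eq_four {β : AlgebraicClosure ℚ}
    (hβ : aeval β ((⟨1, 1, 1, 2, -2⟩ : WeierstrassCurve ℤ).baseChange ℚ).twoTorsionPolynomial.toPoly = 0)
    (κP : ZpExtension ↥(IntermediateField.adjoin ℚ ({β} : Set (AlgebraicClosure ℚ))) 2) (hκP : κP.IsCyclotomic)
    {k : ℕ} {c : ClassGroup (𝓞 (κP.layer k))} (hc : orderOf c = 4) :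
    (∀ m, classGroupPRank κP m ≤ 2 ^ k - 2) ∧ ClassicalMuVanishes κP ∧ classicalLambda κP ≤ 2 ^ k - 2 := by
  haveI := isElliptic_n3523
  haveI := isGloballyMinimal_n3523
  haveI : FiniteDimensional ℚ ↥(IntermediateField.adjoin ℚ ({β} : Set (AlgebraicClosure ℚ))) :=
    IntermediateField.adjoin.finiteDimensional ((AlgebraicClosure.isAlgebraic ℚ).isAlgebraic β).isIntegral
  haveI : NumberField ↥(IntermediateField.adjoin ℚ ({β} : Set (AlgebraicClosure ℚ))) := NumberField.mk
  have hθ := aeval_theta_n3523 hβ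
  have h3 := finrank_cubicField_n3523 hβ
  have hd : ¬ (2 : ℤ) ∣ NumberField.discr ↥(IntermediateField.adjoin ℚ ({β} : Set (AlgebraicClosure ℚ))) := by
    rw [CubicDisc3523.discr_eq h3 hθ]; norm_num
  exact AlignedTransportAtTwoCubicElementaryLayerDoor.classicalMuVanishes_adjoin_of_orderOf_eq_four ((⟨1, 1, 1, 2, -2⟩ : WeierstrassCurve ℤ).baseChange ℚ) not_hasRationalTwoTorsionX_n3523 hβ
    (not_two_dvd_classNumber_cubicField_n3523 hβ) hd κP hκP (le_of_eq (classNumberPExp_one_cubicField_n3523 hβ κP hκP)) hc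

/-- ★ **`C2` AT THE SEED `⟨1, 1, 1, 2, -2⟩` (`N = 3523`) MODULO ONE LAYER CLASS NUMBER**: PRINT⁵ {`h17` Kato 17.4 (1)(2) at `2`, `hGr` Greenberg 4.1, `hper` period unit,
`hmod` modularity, `hGZK`} + `hI` = MuIneqʳ (the registered stub of line `birth`, VERBATIM) + the crux's own hypotheses at this `W` (`r_an = 0`, analytic `μ₂ = 0` on the
even branch, `BSD₂(W)`) + the displayed datum «for every root `β` and every cyclotomic `ℤ₂`-extension of `ℚ(β)` SOME layer has `ord₂ h(K_k) ≠ 2^k − 1`» ⟹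
`MazurMainConjecture W 2` (att-p5 g24's carrier road).  CONDITIONAL; BSD is NOT proved; nothing is closed. [cite: Kato2004Asterisque, Thm. 17.4 (1)(2) (p. 273)]
[cite: GreenbergLNM1716, Thm. 4.1 (p. 102) and Conj. 1.11 (p. 58)] [cite: Iwasawa1973MuInvariants, Thm. 2 and Thm. 3] [cite: Fukuda1994, Thm. 1, p. 264] -/
theorem mazurMainConjecture_two_n3523_of_classNumberPExp_ne
    [((⟨1, 1, 1, 2, -2⟩ : WeierstrassCurve ℤ).baseChange ℚ).IsElliptic] [((⟨1, 1, 1, 2, -2⟩ : WeierstrassCurve ℤ).baseChange ℚ).IsGloballyMinimal]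
    (h17 : ∀ [NeZero (((⟨1, 1, 1, 2, -2⟩ : WeierstrassCurve ℤ).baseChange ℚ).conductorNorm ℤ)] (f : CuspForm (Gamma0 (((⟨1, 1, 1, 2, -2⟩ : WeierstrassCurve ℤ).baseChange ℚ).conductorNorm ℤ)) 2),
      kato_divisibility_allPrimes ((⟨1, 1, 1, 2, -2⟩ : WeierstrassCurve ℤ).baseChange ℚ) 2 (f := f))
    (hGr : Greenberg1999.thm41_charValue_rankZero_anyPrime)
    (hper : realPeriodRat_eq_unit_mul_plusPeriod_two) (hmod : nonempty_modularParametrizationData)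
    (hGZK : rank_eq_analyticRank_of_analyticRank_le_one)
    (hI : ∀ (W : WeierstrassCurve ℚ) [W.IsElliptic] [W.IsGloballyMinimal], IsOrdinaryAt W 2 →
      (∀ x : ℚ, ¬ HasRationalTwoTorsionX W x) →
      ∀ (κ : ZpExtension ℚ 2) (γ : Field.absoluteGaloisGroup ℚ), κ.IsCyclotomic →
      κ.IsTopGenerator γ → IsCyclotomicVariable 2 γ →
      ∀ ⦃N : ℕ⦄ [NeZero N] (f : CuspForm (Gamma0 N) 2), IsNewformOf W f →
      ∀ Gp : IwasawaAlgebra 2, iwasawaToPowerSeries 2 Gp = padicLFunction f (unitRoot W 2 : ℚ_[2]) →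
      ∀ (D : W.SelmerDualData κ γ) (Yr : W.FineSelmerDualDataRelaxedInf κ γ),
        lengthAt (IwasawaAlgebra 2) D.X ⟨IwasawaAlgebra.augIdealP 2, IwasawaAlgebra.isPrime_augIdealP_holds 2⟩ ≤
          lengthAt (IwasawaAlgebra 2) (IwasawaAlgebra 2 ⧸ Ideal.span {Gp})
              ⟨IwasawaAlgebra.augIdealP 2, IwasawaAlgebra.isPrime_augIdealP_holds 2⟩ +
            lengthAt (IwasawaAlgebra 2) Yr.X ⟨IwasawaAlgebra.augIdealP 2, IwasawaAlgebra.isPrime_augIdealP_holds 2⟩)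
    (hr : ((⟨1, 1, 1, 2, -2⟩ : WeierstrassCurve ℤ).baseChange ℚ).analyticRank = 0)
    (hμan : ∀ ⦃N : ℕ⦄ [NeZero N] (f : CuspForm (Gamma0 N) 2), IsNewformOf ((⟨1, 1, 1, 2, -2⟩ : WeierstrassCurve ℤ).baseChange ℚ) f →
      ∀ G : IwasawaAlgebra 2, IsEvenBranchLiftAtTwo ((⟨1, 1, 1, 2, -2⟩ : WeierstrassCurve ℤ).baseChange ℚ) f G → red G ≠ 0)
    (hbsd : BSDp ((⟨1, 1, 1, 2, -2⟩ : WeierstrassCurve ℤ).baseChange ℚ) 2)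
    (hdata : ∀ (β : AlgebraicClosure ℚ), aeval β ((⟨1, 1, 1, 2, -2⟩ : WeierstrassCurve ℤ).baseChange ℚ).twoTorsionPolynomial.toPoly = 0 →
      ∀ κP : ZpExtension ↥(IntermediateField.adjoin ℚ ({β} : Set (AlgebraicClosure ℚ))) 2, κP.IsCyclotomic → ∃ k : ℕ, classNumberPExp κP k ≠ 2 ^ k - 1) :
    MazurMainConjecture ((⟨1, 1, 1, 2, -2⟩ : WeierstrassCurve ℤ).baseChange ℚ) 2 := by
  obtain ⟨β, hβ⟩ := exists_root_twoTorsionPolynomial_n3523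
  have hord : IsOrdinaryAt ((⟨1, 1, 1, 2, -2⟩ : WeierstrassCurve ℤ).baseChange ℚ) 2 := goodOrd_two_n3523
  exact mazurMainConjecture_two_of_muIneqRel_of_classicalMu_cubicField_of_Δ_neg ((⟨1, 1, 1, 2, -2⟩ : WeierstrassCurve ℤ).baseChange ℚ) h17 hGr hper hmod hGZK hI hord
    not_hasRationalTwoTorsionX_n3523 Δ_n3523_neg hr hμan hbsd hβ (fun κP hκP => by
      obtain ⟨k, hk⟩ := hdata β hβ κP hκP
      exact (classicalMuVanishes_cubicField_n3523_of_classNumberPExp_ne hβ κP hκP hk).2.1)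

/-! ## §3 `N = 14891`: the curve `⟨1, 0, 0, -122, -529⟩`, cubic field of discriminant `−14891` -/

/-- The `2`-division cubic of `⟨1, 0, 0, -122, -529⟩` has a root in `ℚ̄`. [cite: SilvermanAEC2009, III.1] -/
theorem exists_root_twoTorsionPolynomial_n14891 :
    ∃ β : AlgebraicClosure ℚ, aeval β ((⟨1, 0, 0, -122, -529⟩ : WeierstrassCurve ℤ).baseChange ℚ).twoTorsionPolynomial.toPoly = 0 := by
  apply IsAlgClosed.exists_aeval_eq_zero
  rw [Cubic.degree_of_a_ne_zero (by simp [WeierstrassCurve.twoTorsionPolynomial])]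
  decide

/-- ★★ **`N = 14891` (hard core): `ord₂ h(K_k) ≠ 2^k − 1` for ONE layer ⟹ `rank₂ Cl(K_m) ≤ 2^k − 2 ∀ m`, `μ₂ = 0`, `λ₂ ≤ 2^k − 2`** — for `β` ANY root of the
`2`-division cubic of `⟨1, 0, 0, -122, -529⟩` and EVERY cyclotomic `ℤ₂`-extension `κ` of `ℚ(β)` (cubic field of discriminant `−14891`); the other inputs of the door (`h = 1`,
`2 ∤ d`, `e₁ = 1`) are tree theorems.  UNCONDITIONAL implication. [cite: Washington1997, §13.3 Prop. 13.22–13.23] [cite: Fukuda1994, Thm. 1, p. 264]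
[cite: LMFDB, number field 3.1.14891.1 (class number 1)] -/
theorem classicalMuVanishes_cubicField_n14891_of_classNumberPExp_ne {β : AlgebraicClosure ℚ}
    (hβ : aeval β ((⟨1, 0, 0, -122, -529⟩ : WeierstrassCurve ℤ).baseChange ℚ).twoTorsionPolynomial.toPoly = 0)
    (κP : ZpExtension ↥(IntermediateField.adjoin ℚ ({β} : Set (AlgebraicClosure ℚ))) 2) (hκP : κP.IsCyclotomic)
    {k : ℕ} (hk : classNumberPExp κP k ≠ 2 ^ k - 1) :
    (∀ m, classGroupPRank κP m ≤ 2 ^ k - 2) ∧ ClassicalMuVanishes κP ∧ classicalLambda κP ≤ 2 ^ k - 2 := by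
  haveI := isElliptic_n14891
  haveI := isGloballyMinimal_n14891
  haveI : FiniteDimensional ℚ ↥(IntermediateField.adjoin ℚ ({β} : Set (AlgebraicClosure ℚ))) :=
    IntermediateField.adjoin.finiteDimensional ((AlgebraicClosure.isAlgebraic ℚ).isAlgebraic β).isIntegral
  haveI : NumberField ↥(IntermediateField.adjoin ℚ ({β} : Set (AlgebraicClosure ℚ))) := NumberField.mk
  have hθ := aeval_theta_n14891 hβ
  have h3 := finrank_cubicField_n14891 hβ
  have hd : ¬ (2 : ℤ) ∣ NumberField.discr ↥(IntermediateField.adjoin ℚ ({β} : Set (AlgebraicClosure ℚ))) := by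
    rw [CubicDisc14891.discr_eq h3 hθ]; norm_num
  exact AlignedTransportAtTwoCubicElementaryLayerDoor.classicalMuVanishes_adjoin_of_classNumberPExp_ne ((⟨1, 0, 0, -122, -529⟩ : WeierstrassCurve ℤ).baseChange ℚ) not_hasRationalTwoTorsionX_n14891 hβ
    (not_two_dvd_classNumber_cubicField_n14891 hβ) hd κP hκP (le_of_eq (classNumberPExp_one_cubicField_n14891 hβ κP hκP)) hk

/-- **`N = 14891`: ONE ideal class of order `4` in some layer `Cl(K_k)` ⟹ `rank₂ Cl(K_m) ≤ 2^k − 2 ∀ m`, `μ₂ = 0`, `λ₂ ≤ 2^k − 2`** (unconditional implication).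
[cite: Washington1997, §13.3 Prop. 13.22–13.23] [cite: Fukuda1994, Thm. 1, p. 264] [cite: LMFDB, number field 3.1.14891.1] -/
theorem classicalMuVanishes_cubicField_n14891_of_orderOf_eq_four {β : AlgebraicClosure ℚ}
    (hβ : aeval β ((⟨1, 0, 0, -122, -529⟩ : WeierstrassCurve ℤ).baseChange ℚ).twoTorsionPolynomial.toPoly = 0)
    (κP : ZpExtension ↥(IntermediateField.adjoin ℚ ({β} : Set (AlgebraicClosure ℚ))) 2) (hκP : κP.IsCyclotomic)
    {k : ℕ} {c : ClassGroup (𝓞 (κP.layer k))} (hc : orderOf c = 4) :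
    (∀ m, classGroupPRank κP m ≤ 2 ^ k - 2) ∧ ClassicalMuVanishes κP ∧ classicalLambda κP ≤ 2 ^ k - 2 := by
  haveI := isElliptic_n14891
  haveI := isGloballyMinimal_n14891
  haveI : FiniteDimensional ℚ ↥(IntermediateField.adjoin ℚ ({β} : Set (AlgebraicClosure ℚ))) :=
    IntermediateField.adjoin.finiteDimensional ((AlgebraicClosure.isAlgebraic ℚ).isAlgebraic β).isIntegral
  haveI : NumberField ↥(IntermediateField.adjoin ℚ ({β} : Set (AlgebraicClosure ℚ))) := NumberField.mk
  have hθ := aeval_theta_n14891 hβ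
  have h3 := finrank_cubicField_n14891 hβ
  have hd : ¬ (2 : ℤ) ∣ NumberField.discr ↥(IntermediateField.adjoin ℚ ({β} : Set (AlgebraicClosure ℚ))) := by
    rw [CubicDisc14891.discr_eq h3 hθ]; norm_num
  exact AlignedTransportAtTwoCubicElementaryLayerDoor.classicalMuVanishes_adjoin_of_orderOf_eq_four ((⟨1, 0, 0, -122, -529⟩ : WeierstrassCurve ℤ).baseChange ℚ) not_hasRationalTwoTorsionX_n14891 hβ
    (not_two_dvd_classNumber_cubicField_n14891 hβ) hd κP hκP (le_of_eq (classNumberPExp_one_cubicField_n14891 hβ κP hκP)) hc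

/-- ★ **`C2` AT THE SEED `⟨1, 0, 0, -122, -529⟩` (`N = 14891`) MODULO ONE LAYER CLASS NUMBER**: PRINT⁵ {`h17` Kato 17.4 (1)(2) at `2`, `hGr` Greenberg 4.1, `hper` period unit,
`hmod` modularity, `hGZK`} + `hI` = MuIneqʳ (the registered stub of line `birth`, VERBATIM) + the crux's own hypotheses at this `W` (`r_an = 0`, analytic `μ₂ = 0` on the
even branch, `BSD₂(W)`) + the displayed datum «for every root `β` and every cyclotomic `ℤ₂`-extension of `ℚ(β)` SOME layer has `ord₂ h(K_k) ≠ 2^k − 1`» ⟹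
`MazurMainConjecture W 2` (att-p5 g24's carrier road).  CONDITIONAL; BSD is NOT proved; nothing is closed. [cite: Kato2004Asterisque, Thm. 17.4 (1)(2) (p. 273)]
[cite: GreenbergLNM1716, Thm. 4.1 (p. 102) and Conj. 1.11 (p. 58)] [cite: Iwasawa1973MuInvariants, Thm. 2 and Thm. 3] [cite: Fukuda1994, Thm. 1, p. 264] -/
theorem mazurMainConjecture_two_n14891_of_classNumberPExp_ne
    [((⟨1, 0, 0, -122, -529⟩ : WeierstrassCurve ℤ).baseChange ℚ).IsElliptic] [((⟨1, 0, 0, -122, -529⟩ : WeierstrassCurve ℤ).baseChange ℚ).IsGloballyMinimal]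
    (h17 : ∀ [NeZero (((⟨1, 0, 0, -122, -529⟩ : WeierstrassCurve ℤ).baseChange ℚ).conductorNorm ℤ)] (f : CuspForm (Gamma0 (((⟨1, 0, 0, -122, -529⟩ : WeierstrassCurve ℤ).baseChange ℚ).conductorNorm ℤ)) 2),
      kato_divisibility_allPrimes ((⟨1, 0, 0, -122, -529⟩ : WeierstrassCurve ℤ).baseChange ℚ) 2 (f := f))
    (hGr : Greenberg1999.thm41_charValue_rankZero_anyPrime)
    (hper : realPeriodRat_eq_unit_mul_plusPeriod_two) (hmod : nonempty_modularParametrizationData)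
    (hGZK : rank_eq_analyticRank_of_analyticRank_le_one)
    (hI : ∀ (W : WeierstrassCurve ℚ) [W.IsElliptic] [W.IsGloballyMinimal], IsOrdinaryAt W 2 →
      (∀ x : ℚ, ¬ HasRationalTwoTorsionX W x) →
      ∀ (κ : ZpExtension ℚ 2) (γ : Field.absoluteGaloisGroup ℚ), κ.IsCyclotomic →
      κ.IsTopGenerator γ → IsCyclotomicVariable 2 γ →
      ∀ ⦃N : ℕ⦄ [NeZero N] (f : CuspForm (Gamma0 N) 2), IsNewformOf W f →
      ∀ Gp : IwasawaAlgebra 2, iwasawaToPowerSeries 2 Gp = padicLFunction f (unitRoot W 2 : ℚ_[2]) →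
      ∀ (D : W.SelmerDualData κ γ) (Yr : W.FineSelmerDualDataRelaxedInf κ γ),
        lengthAt (IwasawaAlgebra 2) D.X ⟨IwasawaAlgebra.augIdealP 2, IwasawaAlgebra.isPrime_augIdealP_holds 2⟩ ≤
          lengthAt (IwasawaAlgebra 2) (IwasawaAlgebra 2 ⧸ Ideal.span {Gp})
              ⟨IwasawaAlgebra.augIdealP 2, IwasawaAlgebra.isPrime_augIdealP_holds 2⟩ +
            lengthAt (IwasawaAlgebra 2) Yr.X ⟨IwasawaAlgebra.augIdealP 2, IwasawaAlgebra.isPrime_augIdealP_holds 2⟩)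
    (hr : ((⟨1, 0, 0, -122, -529⟩ : WeierstrassCurve ℤ).baseChange ℚ).analyticRank = 0)
    (hμan : ∀ ⦃N : ℕ⦄ [NeZero N] (f : CuspForm (Gamma0 N) 2), IsNewformOf ((⟨1, 0, 0, -122, -529⟩ : WeierstrassCurve ℤ).baseChange ℚ) f →
      ∀ G : IwasawaAlgebra 2, IsEvenBranchLiftAtTwo ((⟨1, 0, 0, -122, -529⟩ : WeierstrassCurve ℤ).baseChange ℚ) f G → red G ≠ 0)
    (hbsd : BSDp ((⟨1, 0, 0, -122, -529⟩ : WeierstrassCurve ℤ).baseChange ℚ) 2)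
    (hdata : ∀ (β : AlgebraicClosure ℚ), aeval β ((⟨1, 0, 0, -122, -529⟩ : WeierstrassCurve ℤ).baseChange ℚ).twoTorsionPolynomial.toPoly = 0 →
      ∀ κP : ZpExtension ↥(IntermediateField.adjoin ℚ ({β} : Set (AlgebraicClosure ℚ))) 2, κP.IsCyclotomic → ∃ k : ℕ, classNumberPExp κP k ≠ 2 ^ k - 1) :
    MazurMainConjecture ((⟨1, 0, 0, -122, -529⟩ : WeierstrassCurve ℤ).baseChange ℚ) 2 := by
  obtain ⟨β, hβ⟩ := exists_root_twoTorsionPolynomial_n14891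
  have hord : IsOrdinaryAt ((⟨1, 0, 0, -122, -529⟩ : WeierstrassCurve ℤ).baseChange ℚ) 2 := goodOrd_two_n14891
  exact mazurMainConjecture_two_of_muIneqRel_of_classicalMu_cubicField_of_Δ_neg ((⟨1, 0, 0, -122, -529⟩ : WeierstrassCurve ℤ).baseChange ℚ) h17 hGr hper hmod hGZK hI hord
    not_hasRationalTwoTorsionX_n14891 Δ_n14891_neg hr hμan hbsd hβ (fun κP hκP => by
      obtain ⟨k, hk⟩ := hdata β hβ κP hκP
      exact (classicalMuVanishes_cubicField_n14891_of_classNumberPExp_ne hβ κP hκP hk).2.1)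

end Summit.BirchSwinnertonDyer.BirchSwinnertonDyer.Theorems.AlignedTransportAtTwoCubicElementaryLayerRows

end
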